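import Literature.NumberTheory.Automorphic.HermitianLatticeTreeEulerRelation   -- ★ (T3): the dictionary lemmas `mk_mem_fixedBy_iff_mapGL_latt_eq`, `mk_eq_mk_*`, `edge_latt_coe`, …
import HarnessLib

/-!
# The fixed-coset ∕ fixed-vertex dictionary of the lattice tree, EXPLICIT ON COSETS: `uK ↦ latt u`, `uK′ ↦ latt (u g₁)`, `u(K ⊓ K′) ↦ (latt u, latt (u g₁))`
# — and its equivariance under left multiplication (Kottwitz 1988 §2; Kottwitz 1986 §3; Serre, *Trees*, II.1.1)

Topic `NumberTheory/Automorphic`; namespace `Literature.NumberTheory.Automorphic.HermitianLatticeTree`.  THEOREMS ONLY (no definition, no instance, no notation, no named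
fact, no `sorry`).  (S6) of the tame-RAMIFIED Euler–Poincaré road (R2-ram) — census pen A-p06 (g27) `F0/P3a/A-p06/g27/CENSUS-R2ram-RamifiedEulerPoincare.A-p06g27.md`,
«=» 2026-09-01T09:53:41Z; bytes A-p17 (g22) — for the cell `pub/hodgecm-mathlib` (D-0151), crux H413 (stmt-HodgeConjecture-24833), line «N6nsGerm», letter (R2)
`stub_N6nsR2EP : RankOneEulerPoincareNonsplit`.  ★ (T3) `HermitianLatticeTreeEulerRelation` proves the bijections (A) `Fix_γ(U⧸K) ≃` fixed self-dual vertices,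
(B) `Fix_γ(U⧸K′) ≃` fixed `ϖ`-modular vertices, (I) `Fix_γ(U⧸(K ⊓ K′)) ≃` fixed flags only as `Nonempty (_ ≃ _)`; the NON-ELLIPTIC relation (N) at a ramified place
is a PER-PERIOD count (quotient by `τ^ℤ`, `τ ∈ Z_U(γ)` the split-torus generator; A-p06 (S7)∕(S8) over ★ `OrbitQuotientTransitiveCount` ∕ ★ p843003), which needs
the bijections to be EQUIVARIANT.  This file re-proves them with their values on cosets made explicit — `e [u] = latt u` etc. (stated on representatives,
`(x : U ⧸ K) = ↑u → …`, so that no `•` on the quotient is ever elaborated) — and records the resulting equivariance `e [z u] = latticeTreeIso z (e [u])` for every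
`z ∈ U` (★ `mapGL_coe_latt_mul`, ★ `latticeTreeIso_apply_coe`).  HONEST LABEL: HC_CM is proved only modulo the printed citations until rung 0 closes; nothing printed
is asserted here.

* **`exists_equiv_fixedBy_fixed_selfDual_apply`** (A′), **`exists_equiv_fixedBy_fixed_modular_apply`** (B′), **`exists_equiv_fixedBy_inf_fixed_flags_apply`** (I′),
  **`dictionary_equivariant`** (any coset-explicit dictionary intertwines left multiplication with `latticeTreeIso`).

References: [Kottwitz1988] R. E. Kottwitz, *Tamagawa numbers*, Ann. of Math. 127 (1988), §2; [Kottwitz1986] R. E. Kottwitz, Compositio Math. 60 (1986), §3;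
[Serre1980Trees] J.-P. Serre, *Trees* (1980), I.6.1, II.1.1; [BruhatTits1972] F. Bruhat, J. Tits, Publ. IHÉS 41 (1972), §10.
-/

set_option autoImplicit false

noncomputable section

open scoped ValuativeRel Matrix MatrixGroups
open Matrix ValuativeRel

namespace Literature.NumberTheory.Automorphic.HermitianLatticeTree

variable {E : Type*} [Field E] [ValuativeRel E]

/-! ## §14 The dictionary made explicit on cosets: `uK ↦ latt u`, `uK′ ↦ latt (u g₁)`, `u(K ⊓ K′) ↦ the flag (latt u, latt (u g₁))` -/

section Dictionary

variable (σ : E →+* E) (hσv : ∀ x : E, valuation E (σ x) = valuation E x) {ϖ : E} (hϖ : IsUniformizingElement ϖ)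
  {H : Matrix (Fin 2) (Fin 2) E} (hH : IsUnimodular₂ H)

include hH in
/-- **(A′) `Fix_γ(U ⧸ K) ≃` fixed self-dual vertices, EXPLICITLY `uK ↦ latt u`** — hence equivariant for the centraliser of `γ` (`(zu)K ↦ z · latt u`,
★ `mapGL_coe_latt`), as a period ∕ orbit count needs. [cite: Kottwitz1988, §2] [cite: Kottwitz1986, §3] -/
theorem exists_equiv_fixedBy_fixed_selfDual_apply
    (hA : ∀ M : Submodule 𝒪[E] (Fin 2 → E), IsSelfDualLattice σ H M → ∃ u : ↥(unitaryGroupOfForm σ H), latt (((u : GL (Fin 2) E)) : Matrix (Fin 2) (Fin 2) E) = M) (γ : ↥(unitaryGroupOfForm σ H)) :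
    ∃ e : MulAction.fixedBy (↥(unitaryGroupOfForm σ H) ⧸ (glInt 2 E).subgroupOf (unitaryGroupOfForm σ H)) γ ≃ ↥{v : {M : Submodule 𝒪[E] (Fin 2 → E) // IsSpecialLattice σ ϖ H M} | latticeTreeIso σ ϖ H γ v = v ∧ IsSelfDualLattice σ H v.1},
      ∀ (x : MulAction.fixedBy (↥(unitaryGroupOfForm σ H) ⧸ (glInt 2 E).subgroupOf (unitaryGroupOfForm σ H)) γ) (u : ↥(unitaryGroupOfForm σ H)), (x : ↥(unitaryGroupOfForm σ H) ⧸ (glInt 2 E).subgroupOf (unitaryGroupOfForm σ H)) = (u : ↥(unitaryGroupOfForm σ H) ⧸ (glInt 2 E).subgroupOf (unitaryGroupOfForm σ H)) →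
        ((e x : {M : Submodule 𝒪[E] (Fin 2 → E) // IsSpecialLattice σ ϖ H M}) : Submodule 𝒪[E] (Fin 2 → E)) = latt (((u : GL (Fin 2) E)) : Matrix (Fin 2) (Fin 2) E) := by
  classical
  have hf := fun v : ↥{v : {M : Submodule 𝒪[E] (Fin 2 → E) // IsSpecialLattice σ ϖ H M} | latticeTreeIso σ ϖ H γ v = v ∧ IsSelfDualLattice σ H v.1} =>
    (mk_mem_fixedBy_iff_mapGL_latt_eq σ γ (Classical.choose (hA v.1.1 v.2.2))).2
      (((congrArg (mapGL (γ : GL (Fin 2) E)) (Classical.choose_spec (hA v.1.1 v.2.2))).trans ((latticeTreeIso_apply_eq_self_iff σ _ _).1 v.2.1)).trans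
        (Classical.choose_spec (hA v.1.1 v.2.2)).symm)
  have hbij : Function.Bijective (fun v : ↥{v : {M : Submodule 𝒪[E] (Fin 2 → E) // IsSpecialLattice σ ϖ H M} | latticeTreeIso σ ϖ H γ v = v ∧ IsSelfDualLattice σ H v.1} => (⟨_, hf v⟩ : MulAction.fixedBy (↥(unitaryGroupOfForm σ H) ⧸ (glInt 2 E).subgroupOf (unitaryGroupOfForm σ H)) γ)) := by
    refine ⟨fun v w hvw => ?_, fun x => ?_⟩
    · have h := hvw
      simp only [Subtype.mk.injEq] at h
      have h' := (mk_eq_mk_iff_latt_eq σ _ _).1 h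
      exact Subtype.ext (Subtype.ext (((Classical.choose_spec (hA v.1.1 v.2.2)).symm.trans h').trans
        (Classical.choose_spec (hA w.1.1 w.2.2))))
    · obtain ⟨x, hx⟩ := x
      induction x using QuotientGroup.induction_on with
      | H u =>
        refine ⟨⟨⟨latt (((u : GL (Fin 2) E)) : Matrix (Fin 2) (Fin 2) E), Or.inl (isSelfDualLattice_latt_coe σ hH u)⟩, (latticeTreeIso_apply_eq_self_iff σ _ _).2 ((mk_mem_fixedBy_iff_mapGL_latt_eq σ γ u).1 hx), isSelfDualLattice_latt_coe σ hH u⟩, ?_⟩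
        apply Subtype.ext
        exact (mk_eq_mk_iff_latt_eq σ _ _).2 (Classical.choose_spec (hA _ (isSelfDualLattice_latt_coe σ hH u)))
  refine ⟨(Equiv.ofBijective _ hbij).symm, fun x u hxu => ?_⟩
  obtain ⟨x, hx⟩ := x
  have hx' : ((u : ↥(unitaryGroupOfForm σ H)) : ↥(unitaryGroupOfForm σ H) ⧸ (glInt 2 E).subgroupOf (unitaryGroupOfForm σ H)) ∈ MulAction.fixedBy (↥(unitaryGroupOfForm σ H) ⧸ (glInt 2 E).subgroupOf (unitaryGroupOfForm σ H)) γ := by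
    have h := hx; rwa [show x = (u : ↥(unitaryGroupOfForm σ H) ⧸ (glInt 2 E).subgroupOf (unitaryGroupOfForm σ H)) from hxu] at h
  have key : (Equiv.ofBijective _ hbij).symm ⟨x, hx⟩ =
      ⟨⟨latt (((u : GL (Fin 2) E)) : Matrix (Fin 2) (Fin 2) E), Or.inl (isSelfDualLattice_latt_coe σ hH u)⟩, (latticeTreeIso_apply_eq_self_iff σ _ _).2 ((mk_mem_fixedBy_iff_mapGL_latt_eq σ γ u).1 hx'), isSelfDualLattice_latt_coe σ hH u⟩ := by
    rw [Equiv.symm_apply_eq, Equiv.ofBijective_apply]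
    apply Subtype.ext
    have hxu' : x = ((u : ↥(unitaryGroupOfForm σ H)) : ↥(unitaryGroupOfForm σ H) ⧸ (glInt 2 E).subgroupOf (unitaryGroupOfForm σ H)) := hxu
    exact hxu'.trans ((mk_eq_mk_iff_latt_eq σ _ _).2 (Classical.choose_spec (hA _ (isSelfDualLattice_latt_coe σ hH u)))).symm
  rw [key]

/-- **(B′) `Fix_γ(U ⧸ K′) ≃` fixed `ϖ`-modular vertices, EXPLICITLY `uK′ ↦ latt (u g₁)`** (`K′ = Stab_U(latt g₁)`). [cite: Kottwitz1988, §2] [cite: Kottwitz1986, §3] -/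
theorem exists_equiv_fixedBy_fixed_modular_apply {g₁ : GL (Fin 2) E} (hg₁ : IsModularLattice σ ϖ H (latt (g₁ : Matrix (Fin 2) (Fin 2) E)))
    (hB : ∀ M : Submodule 𝒪[E] (Fin 2 → E), IsModularLattice σ ϖ H M → ∃ u : ↥(unitaryGroupOfForm σ H), latt (((u : GL (Fin 2) E) * g₁ : GL (Fin 2) E) : Matrix (Fin 2) (Fin 2) E) = M) (γ : ↥(unitaryGroupOfForm σ H)) :
    ∃ e : MulAction.fixedBy (↥(unitaryGroupOfForm σ H) ⧸ ((glInt 2 E).map (MulAut.conj g₁).toMonoidHom).subgroupOf (unitaryGroupOfForm σ H)) γ ≃ ↥{v : {M : Submodule 𝒪[E] (Fin 2 → E) // IsSpecialLattice σ ϖ H M} | latticeTreeIso σ ϖ H γ v = v ∧ IsModularLattice σ ϖ H v.1},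
      ∀ (x : MulAction.fixedBy (↥(unitaryGroupOfForm σ H) ⧸ ((glInt 2 E).map (MulAut.conj g₁).toMonoidHom).subgroupOf (unitaryGroupOfForm σ H)) γ) (u : ↥(unitaryGroupOfForm σ H)), (x : ↥(unitaryGroupOfForm σ H) ⧸ ((glInt 2 E).map (MulAut.conj g₁).toMonoidHom).subgroupOf (unitaryGroupOfForm σ H)) = (u : ↥(unitaryGroupOfForm σ H) ⧸ ((glInt 2 E).map (MulAut.conj g₁).toMonoidHom).subgroupOf (unitaryGroupOfForm σ H)) →
        ((e x : {M : Submodule 𝒪[E] (Fin 2 → E) // IsSpecialLattice σ ϖ H M}) : Submodule 𝒪[E] (Fin 2 → E)) = latt (((u : GL (Fin 2) E) * g₁ : GL (Fin 2) E) : Matrix (Fin 2) (Fin 2) E) := by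
  classical
  have hf := fun v : ↥{v : {M : Submodule 𝒪[E] (Fin 2 → E) // IsSpecialLattice σ ϖ H M} | latticeTreeIso σ ϖ H γ v = v ∧ IsModularLattice σ ϖ H v.1} =>
    (mk_mem_fixedBy_conj_iff_mapGL_latt_eq σ g₁ γ (Classical.choose (hB v.1.1 v.2.2))).2
      (((congrArg (mapGL (γ : GL (Fin 2) E)) (Classical.choose_spec (hB v.1.1 v.2.2))).trans ((latticeTreeIso_apply_eq_self_iff σ _ _).1 v.2.1)).trans
        (Classical.choose_spec (hB v.1.1 v.2.2)).symm)
  have hbij : Function.Bijective (fun v : ↥{v : {M : Submodule 𝒪[E] (Fin 2 → E) // IsSpecialLattice σ ϖ H M} | latticeTreeIso σ ϖ H γ v = v ∧ IsModularLattice σ ϖ H v.1} => (⟨_, hf v⟩ : MulAction.fixedBy (↥(unitaryGroupOfForm σ H) ⧸ ((glInt 2 E).map (MulAut.conj g₁).toMonoidHom).subgroupOf (unitaryGroupOfForm σ H)) γ)) := by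
    refine ⟨fun v w hvw => ?_, fun x => ?_⟩
    · have h := hvw
      simp only [Subtype.mk.injEq] at h
      have h' := (mk_eq_mk_conj_iff_latt_eq σ g₁ _ _).1 h
      exact Subtype.ext (Subtype.ext (((Classical.choose_spec (hB v.1.1 v.2.2)).symm.trans h').trans
        (Classical.choose_spec (hB w.1.1 w.2.2))))
    · obtain ⟨x, hx⟩ := x
      induction x using QuotientGroup.induction_on with
      | H u =>
        refine ⟨⟨⟨latt (((u : GL (Fin 2) E) * g₁ : GL (Fin 2) E) : Matrix (Fin 2) (Fin 2) E), Or.inr (isModularLattice_latt_coe_mul σ hg₁ u)⟩, (latticeTreeIso_apply_eq_self_iff σ _ _).2 ((mk_mem_fixedBy_conj_iff_mapGL_latt_eq σ g₁ γ u).1 hx), isModularLattice_latt_coe_mul σ hg₁ u⟩, ?_⟩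
        apply Subtype.ext
        exact (mk_eq_mk_conj_iff_latt_eq σ g₁ _ _).2 (Classical.choose_spec (hB _ (isModularLattice_latt_coe_mul σ hg₁ u)))
  refine ⟨(Equiv.ofBijective _ hbij).symm, fun x u hxu => ?_⟩
  obtain ⟨x, hx⟩ := x
  have hx' : ((u : ↥(unitaryGroupOfForm σ H)) : ↥(unitaryGroupOfForm σ H) ⧸ ((glInt 2 E).map (MulAut.conj g₁).toMonoidHom).subgroupOf (unitaryGroupOfForm σ H)) ∈ MulAction.fixedBy (↥(unitaryGroupOfForm σ H) ⧸ ((glInt 2 E).map (MulAut.conj g₁).toMonoidHom).subgroupOf (unitaryGroupOfForm σ H)) γ := by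
    have h := hx; rwa [show x = (u : ↥(unitaryGroupOfForm σ H) ⧸ ((glInt 2 E).map (MulAut.conj g₁).toMonoidHom).subgroupOf (unitaryGroupOfForm σ H)) from hxu] at h
  have key : (Equiv.ofBijective _ hbij).symm ⟨x, hx⟩ =
      ⟨⟨latt (((u : GL (Fin 2) E) * g₁ : GL (Fin 2) E) : Matrix (Fin 2) (Fin 2) E), Or.inr (isModularLattice_latt_coe_mul σ hg₁ u)⟩, (latticeTreeIso_apply_eq_self_iff σ _ _).2 ((mk_mem_fixedBy_conj_iff_mapGL_latt_eq σ g₁ γ u).1 hx'), isModularLattice_latt_coe_mul σ hg₁ u⟩ := by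
    rw [Equiv.symm_apply_eq, Equiv.ofBijective_apply]
    apply Subtype.ext
    have hxu' : x = ((u : ↥(unitaryGroupOfForm σ H)) : ↥(unitaryGroupOfForm σ H) ⧸ ((glInt 2 E).map (MulAut.conj g₁).toMonoidHom).subgroupOf (unitaryGroupOfForm σ H)) := hxu
    exact hxu'.trans ((mk_eq_mk_conj_iff_latt_eq σ g₁ _ _).2 (Classical.choose_spec (hB _ (isModularLattice_latt_coe_mul σ hg₁ u)))).symm
  rw [key]

include hH in
/-- **(I′) `Fix_γ(U ⧸ (K ⊓ K′)) ≃` fixed flags, EXPLICITLY `u(K ⊓ K′) ↦ (latt u, latt (u g₁))`** (when `U` is transitive on flags). [cite: Kottwitz1988, §2] [cite: Serre1980Trees, II.1.1] -/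
theorem exists_equiv_fixedBy_inf_fixed_flags_apply {g₁ : GL (Fin 2) E} (hg₁ : IsModularLattice σ ϖ H (latt (g₁ : Matrix (Fin 2) (Fin 2) E)))
    (hadj₁ : scaleLattice ϖ (latt (1 : Matrix (Fin 2) (Fin 2) E)) ≤ latt (g₁ : Matrix (Fin 2) (Fin 2) E)) (hadj₂ : latt (g₁ : Matrix (Fin 2) (Fin 2) E) ≤ latt 1)
    (hI : ∀ M N : Submodule 𝒪[E] (Fin 2 → E), IsSelfDualLattice σ H M → IsModularLattice σ ϖ H N → scaleLattice ϖ M ≤ N → N ≤ M →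
      ∃ u : ↥(unitaryGroupOfForm σ H), latt (((u : GL (Fin 2) E)) : Matrix (Fin 2) (Fin 2) E) = M ∧ latt (((u : GL (Fin 2) E) * g₁ : GL (Fin 2) E) : Matrix (Fin 2) (Fin 2) E) = N) (γ : ↥(unitaryGroupOfForm σ H)) :
    ∃ e : MulAction.fixedBy (↥(unitaryGroupOfForm σ H) ⧸ ((glInt 2 E).subgroupOf (unitaryGroupOfForm σ H) ⊓ ((glInt 2 E).map (MulAut.conj g₁).toMonoidHom).subgroupOf (unitaryGroupOfForm σ H))) γ ≃ {p : {M : Submodule 𝒪[E] (Fin 2 → E) // IsSpecialLattice σ ϖ H M} × {M : Submodule 𝒪[E] (Fin 2 → E) // IsSpecialLattice σ ϖ H M} // IsSelfDualLattice σ H p.1.1 ∧ IsModularLattice σ ϖ H p.2.1 ∧ scaleLattice ϖ p.1.1 ≤ p.2.1 ∧ p.2.1 ≤ p.1.1 ∧ latticeTreeIso σ ϖ H γ p.1 = p.1 ∧ latticeTreeIso σ ϖ H γ p.2 = p.2},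
      ∀ (x : MulAction.fixedBy (↥(unitaryGroupOfForm σ H) ⧸ ((glInt 2 E).subgroupOf (unitaryGroupOfForm σ H) ⊓ ((glInt 2 E).map (MulAut.conj g₁).toMonoidHom).subgroupOf (unitaryGroupOfForm σ H))) γ) (u : ↥(unitaryGroupOfForm σ H)), (x : ↥(unitaryGroupOfForm σ H) ⧸ ((glInt 2 E).subgroupOf (unitaryGroupOfForm σ H) ⊓ ((glInt 2 E).map (MulAut.conj g₁).toMonoidHom).subgroupOf (unitaryGroupOfForm σ H))) = (u : ↥(unitaryGroupOfForm σ H) ⧸ ((glInt 2 E).subgroupOf (unitaryGroupOfForm σ H) ⊓ ((glInt 2 E).map (MulAut.conj g₁).toMonoidHom).subgroupOf (unitaryGroupOfForm σ H))) →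
        ((e x : {p : {M : Submodule 𝒪[E] (Fin 2 → E) // IsSpecialLattice σ ϖ H M} × {M : Submodule 𝒪[E] (Fin 2 → E) // IsSpecialLattice σ ϖ H M} // IsSelfDualLattice σ H p.1.1 ∧ IsModularLattice σ ϖ H p.2.1 ∧ scaleLattice ϖ p.1.1 ≤ p.2.1 ∧ p.2.1 ≤ p.1.1 ∧ latticeTreeIso σ ϖ H γ p.1 = p.1 ∧ latticeTreeIso σ ϖ H γ p.2 = p.2}).1.1 : Submodule 𝒪[E] (Fin 2 → E)) = latt (((u : GL (Fin 2) E)) : Matrix (Fin 2) (Fin 2) E) ∧ ((e x : {p : {M : Submodule 𝒪[E] (Fin 2 → E) // IsSpecialLattice σ ϖ H M} × {M : Submodule 𝒪[E] (Fin 2 → E) // IsSpecialLattice σ ϖ H M} // IsSelfDualLattice σ H p.1.1 ∧ IsModularLattice σ ϖ H p.2.1 ∧ scaleLattice ϖ p.1.1 ≤ p.2.1 ∧ p.2.1 ≤ p.1.1 ∧ latticeTreeIso σ ϖ H γ p.1 = p.1 ∧ latticeTreeIso σ ϖ H γ p.2 = p.2}).1.2 : Submodule 𝒪[E] (Fin 2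 → E)) = latt (((u : GL (Fin 2) E) * g₁ : GL (Fin 2) E) : Matrix (Fin 2) (Fin 2) E) := by
  classical
  obtain ⟨φ, hφ⟩ : ∃ φ : {p : {M : Submodule 𝒪[E] (Fin 2 → E) // IsSpecialLattice σ ϖ H M} × {M : Submodule 𝒪[E] (Fin 2 → E) // IsSpecialLattice σ ϖ H M} // IsSelfDualLattice σ H p.1.1 ∧ IsModularLattice σ ϖ H p.2.1 ∧ scaleLattice ϖ p.1.1 ≤ p.2.1 ∧ p.2.1 ≤ p.1.1 ∧ latticeTreeIso σ ϖ H γ p.1 = p.1 ∧ latticeTreeIso σ ϖ H γ p.2 = p.2} → ↥(unitaryGroupOfForm σ H), ∀ p, latt (((φ p : GL (Fin 2) E)) : Matrix (Fin 2) (Fin 2) E) = p.1.1.1 ∧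
      latt (((φ p : GL (Fin 2) E) * g₁ : GL (Fin 2) E) : Matrix (Fin 2) (Fin 2) E) = p.1.2.1 :=
    ⟨fun p => Classical.choose (hI p.1.1.1 p.1.2.1 p.2.1 p.2.2.1 p.2.2.2.1 p.2.2.2.2.1),
      fun p => Classical.choose_spec (hI p.1.1.1 p.1.2.1 p.2.1 p.2.2.1 p.2.2.2.1 p.2.2.2.2.1)⟩
  have hmem := fun p : {p : {M : Submodule 𝒪[E] (Fin 2 → E) // IsSpecialLattice σ ϖ H M} × {M : Submodule 𝒪[E] (Fin 2 → E) // IsSpecialLattice σ ϖ H M} // IsSelfDualLattice σ H p.1.1 ∧ IsModularLattice σ ϖ H p.2.1 ∧ scaleLattice ϖ p.1.1 ≤ p.2.1 ∧ p.2.1 ≤ p.1.1 ∧ latticeTreeIso σ ϖ H γ p.1 = p.1 ∧ latticeTreeIso σ ϖ H γ p.2 = p.2} =>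
    (mk_mem_fixedBy_inf_iff σ g₁ γ (φ p)).2
      ⟨((congrArg (mapGL (γ : GL (Fin 2) E)) (hφ p).1).trans ((latticeTreeIso_apply_eq_self_iff σ _ _).1 p.2.2.2.2.2.1)).trans (hφ p).1.symm,
        ((congrArg (mapGL (γ : GL (Fin 2) E)) (hφ p).2).trans ((latticeTreeIso_apply_eq_self_iff σ _ _).1 p.2.2.2.2.2.2)).trans (hφ p).2.symm⟩
  have hbij : Function.Bijective (fun p : {p : {M : Submodule 𝒪[E] (Fin 2 → E) // IsSpecialLattice σ ϖ H M} × {M : Submodule 𝒪[E] (Fin 2 → E) // IsSpecialLattice σ ϖ H M} // IsSelfDualLattice σ H p.1.1 ∧ IsModularLattice σ ϖ H p.2.1 ∧ scaleLattice ϖ p.1.1 ≤ p.2.1 ∧ p.2.1 ≤ p.1.1 ∧ latticeTreeIso σ ϖ H γ p.1 = p.1 ∧ latticeTreeIso σ ϖ H γ p.2 = p.2} => (⟨_, hmem p⟩ : MulAction.fixedBy (↥(unitaryGroupOfForm σ H) ⧸ ((glInt 2 E).subgroupOf (unitaryGroupOfForm σ H) ⊓ ((glInt 2 E).map (MulAut.conj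 g₁).toMonoidHom).subgroupOf (unitaryGroupOfForm σ H))) γ)) := by
    refine ⟨fun p q hpq => ?_, fun x => ?_⟩
    · have h := hpq
      simp only [Subtype.mk.injEq] at h
      have h' := (mk_eq_mk_inf_iff σ g₁ _ _).1 h
      exact Subtype.ext (Prod.ext (Subtype.ext (((hφ p).1.symm.trans h'.1).trans (hφ q).1)) (Subtype.ext (((hφ p).2.symm.trans h'.2).trans (hφ q).2)))
    · obtain ⟨x, hx⟩ := x
      obtain ⟨p, hp⟩ := exists_fixed_flag_of_mem_fixedBy_inf σ hH hg₁ hadj₁ hadj₂ γ x hx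
      exact ⟨p, Subtype.ext (hp _ (hφ p).1 (hφ p).2)⟩
  refine ⟨(Equiv.ofBijective _ hbij).symm, fun x u hxu => ?_⟩
  obtain ⟨x, hx⟩ := x
  have hx' : ((u : ↥(unitaryGroupOfForm σ H)) : ↥(unitaryGroupOfForm σ H) ⧸ ((glInt 2 E).subgroupOf (unitaryGroupOfForm σ H) ⊓ ((glInt 2 E).map (MulAut.conj g₁).toMonoidHom).subgroupOf (unitaryGroupOfForm σ H))) ∈ MulAction.fixedBy (↥(unitaryGroupOfForm σ H) ⧸ ((glInt 2 E).subgroupOf (unitaryGroupOfForm σ H) ⊓ ((glInt 2 E).map (MulAut.conj g₁).toMonoidHom).subgroupOf (unitaryGroupOfForm σ H))) γ := by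
    have h := hx; rwa [show x = (u : ↥(unitaryGroupOfForm σ H) ⧸ ((glInt 2 E).subgroupOf (unitaryGroupOfForm σ H) ⊓ ((glInt 2 E).map (MulAut.conj g₁).toMonoidHom).subgroupOf (unitaryGroupOfForm σ H))) from hxu] at h
  obtain ⟨h1, h2, h3, h4⟩ := edge_latt_coe σ hH hg₁ hadj₁ hadj₂ u
  have hu' := (mk_mem_fixedBy_inf_iff σ g₁ γ u).1 hx'
  have key : (Equiv.ofBijective _ hbij).symm ⟨x, hx⟩ =
      ⟨(⟨latt (((u : GL (Fin 2) E)) : Matrix (Fin 2) (Fin 2) E), Or.inl h1⟩, ⟨latt (((u : GL (Fin 2) E) * g₁ : GL (Fin 2) E) : Matrix (Fin 2) (Fin 2) E), Or.inr h2⟩),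
        h1, h2, h3, h4, (latticeTreeIso_apply_eq_self_iff σ _ _).2 hu'.1, (latticeTreeIso_apply_eq_self_iff σ _ _).2 hu'.2⟩ := by
    rw [Equiv.symm_apply_eq, Equiv.ofBijective_apply]
    apply Subtype.ext
    have hxu' : x = ((u : ↥(unitaryGroupOfForm σ H)) : ↥(unitaryGroupOfForm σ H) ⧸ ((glInt 2 E).subgroupOf (unitaryGroupOfForm σ H) ⊓
        ((glInt 2 E).map (MulAut.conj g₁).toMonoidHom).subgroupOf (unitaryGroupOfForm σ H))) := hxu
    exact hxu'.trans ((mk_eq_mk_inf_iff σ g₁ _ _).2 ⟨(hφ _).1, (hφ _).2⟩).symm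
  rw [key]
  exact ⟨rfl, rfl⟩

/-- **Equivariance of any coset-explicit dictionary** (vertex version): if `e` sends the coset of `u` to the vertex `latt u` (resp. `latt (u g₁)` — take
`g₁ = 1` for the former), then `e` intertwines LEFT MULTIPLICATION BY `z ∈ U` on representatives with the tree automorphism `latticeTreeIso z`:
`e [z u] = latticeTreeIso z (e [u])`.  With `z` in the centraliser of `γ` this is the `Z(γ)`-equivariance a period ∕ orbit count needs ((S7) of the (R2-ram)
road: quotient by `τ^ℤ` on both sides, ★ `Literature.GroupTheory.OrbitQuotientTransitiveCount`). [cite: Kottwitz1988, §2] -/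
theorem dictionary_equivariant {X : Type*} {S : Set {M : Submodule 𝒪[E] (Fin 2 → E) // IsSpecialLattice σ ϖ H M}} (g₁ : GL (Fin 2) E) (mk : ↥(unitaryGroupOfForm σ H) → X) (e : X → ↥S)
    (he : ∀ (x : X) (u : ↥(unitaryGroupOfForm σ H)), x = mk u → ((e x : {M : Submodule 𝒪[E] (Fin 2 → E) // IsSpecialLattice σ ϖ H M}) : Submodule 𝒪[E] (Fin 2 → E)) = latt (((u : GL (Fin 2) E) * g₁ : GL (Fin 2) E) : Matrix (Fin 2) (Fin 2) E))
    (z u : ↥(unitaryGroupOfForm σ H)) (x y : X) (hx : x = mk u) (hy : y = mk (z * u)) :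
    ((e y : {M : Submodule 𝒪[E] (Fin 2 → E) // IsSpecialLattice σ ϖ H M}) : Submodule 𝒪[E] (Fin 2 → E)) = ((latticeTreeIso σ ϖ H z (e x : {M : Submodule 𝒪[E] (Fin 2 → E) // IsSpecialLattice σ ϖ H M}) : {M : Submodule 𝒪[E] (Fin 2 → E) // IsSpecialLattice σ ϖ H M}) : Submodule 𝒪[E] (Fin 2 → E)) := by
  rw [he y (z * u) hy, latticeTreeIso_apply_coe, he x u hx, ← mapGL_coe_latt_mul σ z u g₁]
  rfl

end Dictionary

end Literature.NumberTheory.Automorphic.HermitianLatticeTree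

end
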